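import Mathlib
import HarnessLib
import Literature.Analysis.FluidPDE.SpaceTimeCalculusC1
import Summits.NavierStokesRegularity.NavierStokesRegularity.Theorems.ChiralWindowDoorDefs
import Summits.NavierStokesRegularity.NavierStokesRegularity.Theorems.CriticalFluxDoorDefs
import Summits.NavierStokesRegularity.NavierStokesRegularity.Theorems.ChiralWindowDoorClassDerivDecay
import Summits.NavierStokesRegularity.NavierStokesRegularity.Theorems.ChiralWindowDoorLambda
import Summits.NavierStokesRegularity.NavierStokesRegularity.Theorems.ChiralWindowDoorCurlCommutes
import Summits.NavierStokesRegularity.NavierStokesRegularity.Theorems.ChiralWindowDoorLocalDissipationLower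
import Summits.NavierStokesRegularity.NavierStokesRegularity.Theorems.ChiralWindowDoorTimeIntegratedError
import Summits.NavierStokesRegularity.NavierStokesRegularity.Theorems.PoloidalWindowDoorPoloidalWindowRigidityWindow
import Summits.NavierStokesRegularity.NavierStokesRegularity.Theorems.CriticalFluxDoorLambdaDecay

/-!
# Door S21-C «CriticalFluxDoor» — the DERIVATIVE SLICES `∂ᵢv(t)` of a door-class profile: decay package, size of
# `Λ∂ᵢv(t)`, and the windowed critical energy `t ↦ Q(a_R, ∂ᵢv(t))` (measurable in `t`, `O((−t)^{−5/2})`, integrable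
# on every `(−∞, t₀)`, `t₀ < 0`)

Door S21-C of nsreg-p1's local Type-I door family (`HOME/ns-regularity-ideate-p1/ROUND-20.md`, texts `r20/Sketch21v3.lean`;
DESIGN-ONLY, route NOT born).  Both open stubs of the residue line, F2 `stub_critDissipationLower` and F3
`stub_critEnergyBudget`, integrate the windowed critical energy of the derivative slices,
`t ↦ Q(a_R, ∂ᵢv(t)) = critEnergy (bumpSq η R) (pderiv i (v t))`, over `(−∞, t₀)` as a Bochner integral; this file shows
that integral is a genuine one.

* `pderiv_slice_package` — for a door-class profile there are `L₁, L₃ ≥ 0` with, for every `t < 0` and `i`: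
  `∂ᵢv(t)` is `C²`, `‖∂ᵢv(t,x)‖ ≤ L₁/(‖x‖+√(−t))²`, `‖D²∂ᵢv(t,x)‖ ≤ L₃/(‖x‖+√(−t))⁴`, and the continuity / sup /
  Lipschitz / second-difference package the Gagliardo–`Λ` identity consumes (orders 1–3 of the tree's scale-invariant
  package `exists_classical_scaleInvariantBounds_of_class`);
* `norm_fracLapHalf_pderiv_le` — `‖Λ∂ᵢv(t,x)‖ ≤ (24|B₁|/π²)(L₁+L₃)/(√(−t)(‖x‖+√(−t))²)`
  (`…CriticalFluxDoorLambdaDecay.norm_fracLapHalf_le_weighted`);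
* `abs_critEnergy_pderiv_le` — `|Q(a_R, ∂ᵢv(t))| ≤ |B_{2R}|·L₁·(24|B₁|/π²)(L₁+L₃)·(−t)^{−5/2}`;
* `aestronglyMeasurable_critEnergy_pderiv` — measurability in `t` (joint continuity of `(t,x) ↦ ∂ᵢv(t,x)` on the open
  backward slab; the `z`-integral defining `Λ` and the `x`-integral defining `Q` are handled by `integral_prod_right'`);
* `integrableOn_critEnergy_pderiv` — **`t ↦ Q(a_R, ∂ᵢv(t))` is integrable on `(−∞, t₀)` for every `t₀ < 0`, `R > 0`.**

Seat nsreg-p6 g13 (THEOREMS-ONLY door sequels, DIRECTOR-NS g8 #32 (2)/#36).  WHAT THIS IS NOT: not NS regularity (Clay A);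
not F2/F3 themselves; no route is opened.
-/

noncomputable section

-- the summit and its single sub-problem share the name (CONVENTIONS §1), as in every Theorems file
set_option linter.dupNamespace false

namespace Summit.NavierStokesRegularity.NavierStokesRegularity.Theorems.CriticalFluxDoorDerivSlice

open MeasureTheory Metric Set Filter Topology Function
open scoped RealInnerProductSpace
open Literature.Analysis Literature.Analysis.FluidPDE
open Summit.NavierStokesRegularity.NavierStokesRegularity.Theorems.ChiralWindowDoorDefs
open Summit.NavierStokesRegularity.NavierStokesRegularity.Theorems.CriticalFluxDoorDefs
open Summit.NavierStokesRegularity.NavierStokesRegularity.Theorems.ChiralWindowDoorClassDerivDecay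
  (exists_classical_scaleInvariantBounds_of_class)
open Summit.NavierStokesRegularity.NavierStokesRegularity.Theorems.ChiralWindowDoorLambda (norm_secondDiff_le)
open Summit.NavierStokesRegularity.NavierStokesRegularity.Theorems.ChiralWindowDoorCurlCommutes (norm_fderiv_two_le)
open Summit.NavierStokesRegularity.NavierStokesRegularity.Theorems.ChiralWindowDoorLocalHelicityLower (continuous_bumpSq)
open Summit.NavierStokesRegularity.NavierStokesRegularity.Theorems.ChiralWindowDoorLocalDissipationLower
  (contDiffOn_uncurry_fderiv_slice prod_restrict_Iio)
open Summit.NavierStokesRegularity.NavierStokesRegularity.Theorems.ChiralWindowDoorTimeIntegratedError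
  (integrableOn_Iio_comp_neg)
open Summit.NavierStokesRegularity.NavierStokesRegularity.Theorems.PoloidalWindowDoorPoloidalWindowRigidityWindow
  (isTypeIAncientMild_of_class)
open Summit.NavierStokesRegularity.NavierStokesRegularity.Theorems.CriticalFluxDoorLambdaDecay
  (norm_fracLapHalf_le_weighted)

variable {C D : ℝ} {v : ℝ → EuclideanSpace ℝ (Fin 3) → EuclideanSpace ℝ (Fin 3)} {η : EuclideanSpace ℝ (Fin 3) → ℝ}

/-! ### The derivative slices of a door-class profile -/

/-- Pointwise: `‖Dⁿ(y ↦ Dg(y)e)(y)‖ ≤ ‖e‖·‖Dⁿ⁺¹g(y)‖` for a `C^{n+1}` field. -/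
theorem norm_iteratedFDeriv_fderiv_apply_le {g : EuclideanSpace ℝ (Fin 3) → EuclideanSpace ℝ (Fin 3)} {N : ℕ}
    (hg : ContDiff ℝ (N + 1) g) (e : EuclideanSpace ℝ (Fin 3)) {n : ℕ} (hn : n ≤ N) (y : EuclideanSpace ℝ (Fin 3)) :
    ‖iteratedFDeriv ℝ n (fun y => fderiv ℝ g y e) y‖ ≤ ‖e‖ * ‖iteratedFDeriv ℝ (n + 1) g y‖ := by
  have hD : ContDiff ℝ N (fderiv ℝ g) := hg.fderiv_right (m := N) (by norm_cast)
  have h := norm_iteratedFDeriv_clm_apply_const (f := fderiv ℝ g) (c := e) (x := y) (n := n) hD.contDiffAt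
    (by exact_mod_cast hn)
  rwa [norm_iteratedFDeriv_fderiv] at h

/-- **The derivative-slice package of a door-class profile.**  There are `L₁, L₃ ≥ 0` such that for every `t < 0` and
every coordinate direction `i`, the slice `∂ᵢv(t) = pderiv i (v t)` is `C²`, decays like `L₁/(‖x‖+√(−t))²`, has second
derivatives `≤ L₃/(‖x‖+√(−t))⁴`, and is continuous, bounded, Lipschitz, with quadratic second differences (some
constants depending on `t`). -/
theorem pderiv_slice_package (hrate : HasTypeITimeDecay C v) (hdecay : HasTypeIDecay D v)
    (hcont : ContinuousOn (Function.uncurry v) (Set.Iio (0 : ℝ) ×ˢ Set.univ))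
    (hmild : ∀ s t : ℝ, s < t → t < 0 → ∀ x,
      v t x = UnboundedOperators.heatExtension (v s) (t - s) x - oseenDuhamel 1 s v v t x)
    (hdiv : ∀ t < 0, VectorCalculus.IsDivFree (v t)) :
    ∃ L₁ L₃ : ℝ, 0 ≤ L₁ ∧ 0 ≤ L₃ ∧ ∀ t < (0 : ℝ), ∀ i : Fin 3,
      ContDiff ℝ 2 (pderiv i (v t)) ∧
      (∀ x, ‖pderiv i (v t) x‖ ≤ L₁ / (‖x‖ + Real.sqrt (-t)) ^ 2) ∧
      (∀ x, ‖fderiv ℝ (fderiv ℝ (pderiv i (v t))) x‖ ≤ L₃ / (‖x‖ + Real.sqrt (-t)) ^ 4) ∧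
      ∃ N₀ N₁ N₂ : ℝ, Continuous (pderiv i (v t)) ∧ (∀ x, ‖pderiv i (v t) x‖ ≤ N₀) ∧
        (∀ x y, ‖pderiv i (v t) x - pderiv i (v t) y‖ ≤ N₁ * ‖x - y‖) ∧
        ∀ x z, ‖(2 : ℝ) • pderiv i (v t) x - pderiv i (v t) (x + z) - pderiv i (v t) (x - z)‖ ≤ N₂ * ‖z‖ ^ 2 := by
  obtain ⟨Q, hsol, hSIB⟩ := exists_classical_scaleInvariantBounds_of_class hrate hdecay hcont hmild hdiv
  obtain ⟨L₁, hL₁⟩ := hSIB 1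
  obtain ⟨L₂, hL₂⟩ := hSIB 2
  obtain ⟨L₃, hL₃⟩ := hSIB 3
  -- signs
  have hnn : ∀ {L : ℝ} {n : ℕ}, (∀ t < (0 : ℝ), ∀ x : EuclideanSpace ℝ (Fin 3),
      ‖iteratedFDeriv ℝ n (v t) x‖ ≤ L / (‖x‖ + Real.sqrt (-t)) ^ (1 + n)) → 0 ≤ L := by
    intro L n h
    have h0 := h (-1) (by norm_num) 0
    have hpos : 0 < (‖(0 : EuclideanSpace ℝ (Fin 3))‖ + Real.sqrt (-(-1 : ℝ))) ^ (1 + n) := by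
      rw [norm_zero, zero_add]; exact pow_pos (Real.sqrt_pos.2 (by norm_num)) _
    by_contra hL
    push Not at hL
    have : L / (‖(0 : EuclideanSpace ℝ (Fin 3))‖ + Real.sqrt (-(-1 : ℝ))) ^ (1 + n) < 0 := div_neg_of_neg_of_pos hL hpos
    linarith [norm_nonneg (iteratedFDeriv ℝ n (v (-1)) 0)]
  have hL₁nn : 0 ≤ L₁ := hnn fun t ht x => (hL₁ t ht x).1
  have hL₃nn : 0 ≤ L₃ := hnn fun t ht x => (hL₃ t ht x).1
  refine ⟨L₁, L₃, hL₁nn, hL₃nn, fun t ht i => ?_⟩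
  have hnt : 0 < -t := neg_pos.2 ht
  have hsq : 0 < Real.sqrt (-t) := Real.sqrt_pos.2 hnt
  set e : EuclideanSpace ℝ (Fin 3) := EuclideanSpace.single i 1 with he
  have he1 : ‖e‖ = 1 := by rw [he, PiLp.norm_single, norm_one]
  have hcd : ContDiff ℝ 4 (v t) := contDiff_infty.1 (hsol.contDiff_velocity ht) 4
  have hcd3 : ContDiff ℝ 3 (v t) := hcd.of_le (by norm_cast)
  have hpd : pderiv i (v t) = fun y => fderiv ℝ (v t) y e := funext fun y => pderiv_eq i (v t) y
  have hpcd : ContDiff ℝ 3 (pderiv i (v t)) := by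
    rw [hpd]; exact (hcd.fderiv_right (m := 3) (by norm_cast)).clm_apply contDiff_const
  have hpcd2 : ContDiff ℝ 2 (pderiv i (v t)) := hpcd.of_le (by norm_cast)
  -- uniform-in-`x` forms of the bounds (denominators ≥ powers of `√(−t)`)
  have hden : ∀ (x : EuclideanSpace ℝ (Fin 3)) (n : ℕ), Real.sqrt (-t) ^ n ≤ (‖x‖ + Real.sqrt (-t)) ^ n :=
    fun x n => pow_le_pow_left₀ hsq.le (by linarith [norm_nonneg x]) n
  have hunif : ∀ {L : ℝ} {n : ℕ} (x : EuclideanSpace ℝ (Fin 3)), 0 ≤ L →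
      ‖iteratedFDeriv ℝ n (v t) x‖ ≤ L / (‖x‖ + Real.sqrt (-t)) ^ (1 + n) →
        ‖iteratedFDeriv ℝ n (v t) x‖ ≤ L / Real.sqrt (-t) ^ (1 + n) := by
    intro L n x hL h
    exact h.trans (div_le_div_of_nonneg_left hL (by positivity) (hden x _))
  -- (a) decay of `∂ᵢv`
  have hdec : ∀ x, ‖pderiv i (v t) x‖ ≤ L₁ / (‖x‖ + Real.sqrt (-t)) ^ 2 := by
    intro x
    have h1 := (hL₁ t ht x).1
    rw [norm_iteratedFDeriv_one] at h1
    rw [pderiv_eq]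
    calc ‖fderiv ℝ (v t) x (EuclideanSpace.single i 1)‖ ≤ ‖fderiv ℝ (v t) x‖ * ‖e‖ :=
          ContinuousLinearMap.le_opNorm _ _
      _ ≤ L₁ / (‖x‖ + Real.sqrt (-t)) ^ (1 + 1) * 1 := by rw [he1]; gcongr
      _ = L₁ / (‖x‖ + Real.sqrt (-t)) ^ 2 := by norm_num
  -- (b) second derivatives of `∂ᵢv`
  have hD2 : ∀ x, ‖fderiv ℝ (fderiv ℝ (pderiv i (v t))) x‖ ≤ L₃ / (‖x‖ + Real.sqrt (-t)) ^ 4 := by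
    intro x
    have h3 := (hL₃ t ht x).1
    have h := norm_iteratedFDeriv_fderiv_apply_le (N := 3) hcd e (n := 2) (by norm_num) x
    rw [he1, one_mul, ← hpd] at h
    rw [← norm_iteratedFDeriv_one (𝕜 := ℝ) (fderiv ℝ (pderiv i (v t))), norm_iteratedFDeriv_fderiv]
    exact h.trans (by simpa using h3)
  -- (c) the sup / Lipschitz / second-difference package
  have hN₀ : ∀ x, ‖pderiv i (v t) x‖ ≤ L₁ / Real.sqrt (-t) ^ 2 := fun x =>
    (hdec x).trans (div_le_div_of_nonneg_left hL₁nn (by positivity) (hden x 2))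
  have hL₂nn : 0 ≤ L₂ := hnn fun t ht x => (hL₂ t ht x).1
  have hD1 : ∀ x, ‖fderiv ℝ (pderiv i (v t)) x‖ ≤ L₂ / Real.sqrt (-t) ^ (1 + 2) := by
    intro x
    have h := norm_iteratedFDeriv_fderiv_apply_le (N := 3) hcd e (n := 1) (by norm_num) x
    rw [he1, one_mul, ← hpd, norm_iteratedFDeriv_one] at h
    exact h.trans (hunif x hL₂nn (hL₂ t ht x).1)
  have hD2u : ∀ x, ‖fderiv ℝ (fderiv ℝ (pderiv i (v t))) x‖ ≤ L₃ / Real.sqrt (-t) ^ 4 := fun x =>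
    (hD2 x).trans (div_le_div_of_nonneg_left hL₃nn (by positivity) (hden x 4))
  refine ⟨hpcd2, hdec, hD2, L₁ / Real.sqrt (-t) ^ 2, L₂ / Real.sqrt (-t) ^ (1 + 2), 2 * (L₃ / Real.sqrt (-t) ^ 4),
    hpcd.continuous, hN₀, fun x y => ?_, fun x z => norm_secondDiff_le hpcd2 hD2u x z⟩
  exact Convex.norm_image_sub_le_of_norm_fderiv_le (fun z _ => hpcd.differentiable (by norm_cast) z)
    (fun z _ => hD1 z) convex_univ (mem_univ y) (mem_univ x)

/-! ### The size of `Λ∂ᵢv(t)` and of `Q(a_R, ∂ᵢv(t))` -/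

/-- **`‖Λ∂ᵢv(t,x)‖ ≤ (24|B₁|/π²)(L₁+L₃)/(√(−t)·(‖x‖+√(−t))²)`**: the weighted `Λ`-decay lemma with `A = L₁/√(−t)`,
`B = L₃/√(−t)` (one power of the denominators is spent to reach the lemma's exponents `1` and `3`). -/
theorem norm_fracLapHalf_pderiv_le {f : EuclideanSpace ℝ (Fin 3) → EuclideanSpace ℝ (Fin 3)} (hf : ContDiff ℝ 2 f)
    {L₁ L₃ a : ℝ} (ha : 0 < a) (hL₁ : 0 ≤ L₁) (hL₃ : 0 ≤ L₃)
    (h1 : ∀ y, ‖f y‖ ≤ L₁ / (‖y‖ + a) ^ 2) (h3 : ∀ y, ‖fderiv ℝ (fderiv ℝ f) y‖ ≤ L₃ / (‖y‖ + a) ^ 4)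
    (x : EuclideanSpace ℝ (Fin 3)) :
    ‖fracLapHalf f x‖ ≤ lamDecayConst * (L₁ / a + L₃ / a) / (‖x‖ + a) ^ 2 := by
  have hA : ∀ y, ‖f y‖ ≤ (L₁ / a) / (‖y‖ + a) := by
    intro y
    have hya : a ≤ ‖y‖ + a := le_add_of_nonneg_left (norm_nonneg y)
    have hpos : 0 < ‖y‖ + a := by positivity
    calc ‖f y‖ ≤ L₁ / (‖y‖ + a) ^ 2 := h1 y
      _ = L₁ / (‖y‖ + a) / (‖y‖ + a) := by rw [pow_two, div_div]
      _ ≤ L₁ / a / (‖y‖ + a) := by gcongr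
  have hB : ∀ y, ‖fderiv ℝ (fderiv ℝ f) y‖ ≤ (L₃ / a) / (‖y‖ + a) ^ 3 := by
    intro y
    have hya : a ≤ ‖y‖ + a := le_add_of_nonneg_left (norm_nonneg y)
    have hpos : 0 < ‖y‖ + a := by positivity
    calc ‖fderiv ℝ (fderiv ℝ f) y‖ ≤ L₃ / (‖y‖ + a) ^ 4 := h3 y
      _ = L₃ / (‖y‖ + a) / (‖y‖ + a) ^ 3 := by rw [div_div, ← pow_succ']
      _ ≤ L₃ / a / (‖y‖ + a) ^ 3 := by gcongr
  exact norm_fracLapHalf_le_weighted hf ha hA hB x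

/-- **`|Q(a_R, ∂ᵢv(t))| ≤ |B_{2R}(0)|·L₁·(24|B₁|/π²)(L₁+L₃)·(−t)^{−5/2}`** (`R > 0`, `t < 0`): the integrand of `Q` is
dominated by a constant on `B_{2R}` and vanishes off it. -/
theorem abs_critEnergy_pderiv_le (hη : IsAdmissibleBump η) {f : EuclideanSpace ℝ (Fin 3) → EuclideanSpace ℝ (Fin 3)}
    (hf : ContDiff ℝ 2 f) {L₁ L₃ a : ℝ} (ha : 0 < a) (hL₁ : 0 ≤ L₁) (hL₃ : 0 ≤ L₃)
    (h1 : ∀ y, ‖f y‖ ≤ L₁ / (‖y‖ + a) ^ 2) (h3 : ∀ y, ‖fderiv ℝ (fderiv ℝ f) y‖ ≤ L₃ / (‖y‖ + a) ^ 4)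
    {R : ℝ} (hR : 0 < R) :
    |critEnergy (bumpSq η R) f| ≤
      (volume : Measure (EuclideanSpace ℝ (Fin 3))).real (ball 0 (2 * R)) *
        (L₁ * (lamDecayConst * (L₁ + L₃))) * a ^ (-(5 : ℝ)) := by
  set M : ℝ := L₁ / a ^ 2 * (lamDecayConst * (L₁ / a + L₃ / a) / a ^ 2) with hM
  have hM0 : 0 ≤ M := by have := lamDecayConst_nonneg; positivity
  have hpt : ∀ x, ‖bumpSq η R x * ⟪f x, fracLapHalf f x⟫‖ ≤
      (ball (0 : EuclideanSpace ℝ (Fin 3)) (2 * R)).indicator (fun _ => M) x := by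
    intro x
    by_cases hx : x ∈ ball (0 : EuclideanSpace ℝ (Fin 3)) (2 * R)
    · rw [indicator_of_mem hx, Real.norm_eq_abs, abs_mul, abs_of_nonneg (bumpSq_nonneg η R x)]
      have hb1 : bumpSq η R x ≤ 1 := bumpSq_le_one hη R x
      have hxa : a ≤ ‖x‖ + a := le_add_of_nonneg_left (norm_nonneg x)
      have hfx : ‖f x‖ ≤ L₁ / a ^ 2 :=
        (h1 x).trans (div_le_div_of_nonneg_left hL₁ (by positivity) (pow_le_pow_left₀ ha.le hxa 2))
      have hΛ : ‖fracLapHalf f x‖ ≤ lamDecayConst * (L₁ / a + L₃ / a) / a ^ 2 := by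
        refine (norm_fracLapHalf_pderiv_le hf ha hL₁ hL₃ h1 h3 x).trans ?_
        have := lamDecayConst_nonneg
        exact div_le_div_of_nonneg_left (by positivity) (by positivity) (pow_le_pow_left₀ ha.le hxa 2)
      calc bumpSq η R x * |⟪f x, fracLapHalf f x⟫| ≤ 1 * (‖f x‖ * ‖fracLapHalf f x‖) :=
            mul_le_mul hb1 (abs_real_inner_le_norm _ _) (abs_nonneg _) zero_le_one
        _ ≤ M := by rw [one_mul, hM]; exact mul_le_mul hfx hΛ (norm_nonneg _) (by positivity)
    · rw [indicator_of_notMem hx]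
      have hx' : 2 * R ≤ ‖x‖ := by rwa [mem_ball_zero_iff, not_lt] at hx
      rw [bumpSq_eq_zero hη hR hx', zero_mul, norm_zero]
  have hint : Integrable ((ball (0 : EuclideanSpace ℝ (Fin 3)) (2 * R)).indicator fun _ => M) :=
    (integrable_indicator_iff measurableSet_ball).2 (integrableOn_const measure_ball_lt_top.ne)
  have h := norm_integral_le_of_norm_le hint (ae_of_all _ hpt)
  rw [integral_indicator_const M measurableSet_ball, smul_eq_mul, Real.norm_eq_abs] at h
  rw [critEnergy_eq]
  refine h.trans (le_of_eq ?_)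
  have ha5 : a ^ (-(5 : ℝ)) = (a ^ 5)⁻¹ := by
    rw [Real.rpow_neg ha.le, show (5 : ℝ) = ((5 : ℕ) : ℝ) by norm_num, Real.rpow_natCast]
  rw [hM, ha5]
  field_simp

/-! ### Measurability of `t ↦ Q(a_R, ∂ᵢv(t))` -/

/-- **`t ↦ Q(a_R, ∂ᵢv(t))` is a.e.-strongly measurable on `(−∞, t₀)`, `t₀ ≤ 0`** (joint smoothness of the profile on
the open backward slab; the `z`-integral of `Λ` and the `x`-integral of `Q` through `integral_prod_right'`). -/
theorem aestronglyMeasurable_critEnergy_pderiv (hv : ContDiffOn ℝ 2 (uncurry v) (Iio (0 : ℝ) ×ˢ univ))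
    (hη : IsAdmissibleBump η) (R : ℝ) {t₀ : ℝ} (ht₀ : t₀ ≤ 0) (i : Fin 3) :
    AEStronglyMeasurable (fun t => critEnergy (bumpSq η R) (pderiv i (v t))) (volume.restrict (Iio t₀)) := by
  -- the derivative slice as a jointly continuous field on the slab `Iio t₀ × ℝ³`
  set S : Set (ℝ × EuclideanSpace ℝ (Fin 3)) := Iio t₀ ×ˢ univ with hS
  have hSm : MeasurableSet S := measurableSet_Iio.prod MeasurableSet.univ
  have hsub : S ⊆ Iio (0 : ℝ) ×ˢ univ := prod_mono (Iio_subset_Iio ht₀) subset_rfl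
  set P : ℝ × EuclideanSpace ℝ (Fin 3) → EuclideanSpace ℝ (Fin 3) := fun q => pderiv i (v q.1) q.2 with hP
  have hPc : ContinuousOn P S := by
    have h := ((contDiffOn_uncurry_fderiv_slice (m := 0) hv (by norm_num)).continuousOn).mono hsub
    have h' : ContinuousOn (fun q : ℝ × EuclideanSpace ℝ (Fin 3) =>
        fderiv ℝ (v q.1) q.2 (EuclideanSpace.single i 1)) S := h.clm_apply continuousOn_const
    refine h'.congr fun q _ => ?_
    rw [hP]; exact pderiv_eq i (v q.1) q.2
  -- the second-difference integrand on `S × ℝ³`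
  set H : (ℝ × EuclideanSpace ℝ (Fin 3)) × EuclideanSpace ℝ (Fin 3) → EuclideanSpace ℝ (Fin 3) := fun r =>
    lamK r.2 • ((2 : ℝ) • P r.1 - P (r.1.1, r.1.2 + r.2) - P (r.1.1, r.1.2 - r.2)) with hH
  have hmapsP : MapsTo (fun r : (ℝ × EuclideanSpace ℝ (Fin 3)) × EuclideanSpace ℝ (Fin 3) => (r.1.1, r.1.2 + r.2))
      (S ×ˢ univ) S := fun r hr => ⟨(mem_prod.1 (mem_prod.1 hr).1).1, mem_univ _⟩
  have hmapsM : MapsTo (fun r : (ℝ × EuclideanSpace ℝ (Fin 3)) × EuclideanSpace ℝ (Fin 3) => (r.1.1, r.1.2 - r.2))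
      (S ×ˢ univ) S := fun r hr => ⟨(mem_prod.1 (mem_prod.1 hr).1).1, mem_univ _⟩
  have hmapsO : MapsTo (fun r : (ℝ × EuclideanSpace ℝ (Fin 3)) × EuclideanSpace ℝ (Fin 3) => r.1)
      (S ×ˢ univ) S := fun r hr => (mem_prod.1 hr).1
  have hcP : Continuous (fun r : (ℝ × EuclideanSpace ℝ (Fin 3)) × EuclideanSpace ℝ (Fin 3) => (r.1.1, r.1.2 + r.2)) :=
    (continuous_fst.comp continuous_fst).prodMk ((continuous_snd.comp continuous_fst).add continuous_snd)
  have hcM : Continuous (fun r : (ℝ × EuclideanSpace ℝ (Fin 3)) × EuclideanSpace ℝ (Fin 3) => (r.1.1, r.1.2 - r.2)) :=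
    (continuous_fst.comp continuous_fst).prodMk ((continuous_snd.comp continuous_fst).sub continuous_snd)
  have hHin : ContinuousOn (fun r : (ℝ × EuclideanSpace ℝ (Fin 3)) × EuclideanSpace ℝ (Fin 3) =>
      (2 : ℝ) • P r.1 - P (r.1.1, r.1.2 + r.2) - P (r.1.1, r.1.2 - r.2)) (S ×ˢ univ) :=
    (((hPc.comp continuous_fst.continuousOn hmapsO).const_smul (2 : ℝ)).sub (hPc.comp hcP.continuousOn hmapsP)).sub
      (hPc.comp hcM.continuousOn hmapsM)
  have hHm : AEStronglyMeasurable H ((volume.restrict S).prod volume) := by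
    have hprod : (volume.restrict S).prod (volume : Measure (EuclideanSpace ℝ (Fin 3))) =
        (volume.prod volume).restrict (S ×ˢ univ) := by
      conv_lhs => rw [← Measure.restrict_univ (μ := (volume : Measure (EuclideanSpace ℝ (Fin 3))))]
      rw [Measure.prod_restrict]
    rw [hprod, hH]
    exact (measurable_lamK.comp measurable_snd).aestronglyMeasurable.smul
      (hHin.aestronglyMeasurable (hSm.prod MeasurableSet.univ))
  -- `q ↦ Λ(∂ᵢv(q.1))(q.2)` is measurable on `S`
  have hΛ : AEStronglyMeasurable (fun q : ℝ × EuclideanSpace ℝ (Fin 3) => fracLapHalf (pderiv i (v q.1)) q.2)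
      (volume.restrict S) := by
    have h := (hHm.integral_prod_right').const_smul (1 / 2 : ℝ)
    refine h.congr (ae_of_all _ fun q => ?_)
    rw [hH]; rfl
  -- the integrand of `Q` on `S`, then the `x`-integral
  have hF : AEStronglyMeasurable (fun q : ℝ × EuclideanSpace ℝ (Fin 3) =>
      bumpSq η R q.2 * ⟪P q, fracLapHalf (pderiv i (v q.1)) q.2⟫) (volume.restrict S) := by
    refine (((continuous_bumpSq hη R).comp continuous_snd).aestronglyMeasurable.restrict).mul ?_
    exact (hPc.aestronglyMeasurable hSm).inner hΛ
  have hF' : AEStronglyMeasurable (fun q : ℝ × EuclideanSpace ℝ (Fin 3) =>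
      bumpSq η R q.2 * ⟪P q, fracLapHalf (pderiv i (v q.1)) q.2⟫)
      (((volume : Measure ℝ).restrict (Iio t₀)).prod volume) := by
    rw [prod_restrict_Iio]; exact hF
  refine (hF'.integral_prod_right').congr (ae_of_all _ fun t => ?_)
  show (∫ y : EuclideanSpace ℝ (Fin 3), bumpSq η R y * ⟪P (t, y), fracLapHalf (pderiv i (v t)) y⟫) =
    critEnergy (bumpSq η R) (pderiv i (v t))
  rw [critEnergy_eq]

/-! ### Integrability of `t ↦ Q(a_R, ∂ᵢv(t))` on `(−∞, t₀)` -/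

/-- **`t ↦ Q(a_R, ∂ᵢv(t))` is integrable on `(−∞, t₀)`** for a door-class profile, `R > 0`, `t₀ < 0`, every `i`
(measurable, and `O((−t)^{−5/2})` with `∫_{t<t₀}(−t)^{−5/2}dt < ∞`). -/
theorem integrableOn_critEnergy_pderiv (hη : IsAdmissibleBump η) (hrate : HasTypeITimeDecay C v)
    (hdecay : HasTypeIDecay D v) (hcont : ContinuousOn (Function.uncurry v) (Set.Iio (0 : ℝ) ×ˢ Set.univ))
    (hmild : ∀ s t : ℝ, s < t → t < 0 → ∀ x,
      v t x = UnboundedOperators.heatExtension (v s) (t - s) x - oseenDuhamel 1 s v v t x)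
    (hdiv : ∀ t < 0, VectorCalculus.IsDivFree (v t)) {R : ℝ} (hR : 0 < R) {t₀ : ℝ} (ht₀ : t₀ < 0) (i : Fin 3) :
    IntegrableOn (fun t => critEnergy (bumpSq η R) (pderiv i (v t))) (Iio t₀) := by
  obtain ⟨L₁, L₃, hL₁, hL₃, hpkg⟩ := pderiv_slice_package hrate hdecay hcont hmild hdiv
  have hsmooth : ContDiffOn ℝ 2 (uncurry v) (Iio (0 : ℝ) ×ˢ univ) :=
    (isTypeIAncientMild_of_class hrate hcont hmild hdiv).1.of_le (by norm_cast)
  have hmeas := aestronglyMeasurable_critEnergy_pderiv hsmooth hη R ht₀.le i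
  set K : ℝ := (volume : Measure (EuclideanSpace ℝ (Fin 3))).real (ball 0 (2 * R)) *
    (L₁ * (lamDecayConst * (L₁ + L₃))) with hK
  -- the majorant `K · (√(−t))^{−5}` is integrable on `(−∞, t₀)`
  have hmaj : IntegrableOn (fun t : ℝ => K * Real.sqrt (-t) ^ (-(5 : ℝ))) (Iio t₀) := by
    have h1 : IntegrableOn (fun s : ℝ => s ^ (-(5 : ℝ) / 2)) (Ioi (-t₀)) :=
      integrableOn_Ioi_rpow_of_lt (by norm_num) (neg_pos.2 ht₀)
    have h2 : IntegrableOn (fun s : ℝ => K * s ^ (-(5 : ℝ) / 2)) (Ioi (-t₀)) := h1.const_mul K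
    have h3 := integrableOn_Iio_comp_neg (c := t₀) h2
    refine h3.congr_fun (fun t ht => ?_) measurableSet_Iio
    have hnt : 0 ≤ -t := by have : t < t₀ := ht; linarith
    show K * (-t) ^ (-(5 : ℝ) / 2) = K * Real.sqrt (-t) ^ (-(5 : ℝ))
    rw [Real.sqrt_eq_rpow, ← Real.rpow_mul hnt]
    norm_num
  refine Integrable.mono' hmaj hmeas ((ae_restrict_iff' measurableSet_Iio).2 (ae_of_all _ fun t ht => ?_))
  have ht0 : t < 0 := lt_trans ht ht₀
  have hsq : 0 < Real.sqrt (-t) := Real.sqrt_pos.2 (neg_pos.2 ht0)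
  obtain ⟨hcd, hdec, hD2, -⟩ := hpkg t ht0 i
  rw [Real.norm_eq_abs]
  exact abs_critEnergy_pderiv_le hη hcd hsq hL₁ hL₃ hdec hD2 hR

end Summit.NavierStokesRegularity.NavierStokesRegularity.Theorems.CriticalFluxDoorDerivSlice

end
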